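import Mathlib
import Summits.SmoothPoincare4.SmoothPoincare4.Theses.EntropyRung
import Literature.Geometry.Riemannian.PerelmanEntropy
import Literature.Geometry.Riemannian.RicciFlowMaximal
import Literature.Geometry.Riemannian.CurvatureOperator
import Literature.Geometry.Riemannian.ConstantCurvature
import Literature.Geometry.Riemannian.HamiltonPCOClassification
import Literature.Topology.FourManifolds.HomotopyS4SimplyConnected
import Literature.Topology.FourManifolds.SphereSimplyConnected

/-!
# Sketch — crux `SubcylindricalRecognition` (stmt-SmoothPoincare4-10869), crux-ideate round 1, ideator 3 (gen 2)

First lemmas of the three crux-idea cards of ideator 3, typed over Mathlib + the route file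
`Theses/EntropyRung.lean` + the Literature Ricci-flow vocabulary (`IsRicciFlow`,
`IsContMDiffFamilyOn`, `muEntropy`, `HasPositiveCurvatureOperator`, `CurvatureBoundedBy`-style frame
bounds, `HasConstantSectionalCurvatureWith`).  Nothing deep is proved; the two `theorem`s are the
sanity compositions "transfer ⇒ crux" for card 1 and "dichotomy + AC gap ⇒ bounded-curvature
non-compact gap" for card 3.

* Card `stable-window-genericity`: `DenseRoundExit` (transfer C⁺), `rung_of_denseRoundExit`
  (C⁺ + Hamilton 1986 + π₁(S⁴)=1 ⇒ the crux, PROVED), `IsCurvewiseNuMax`, `StableCompactWindow`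
  (first lemma: Cao's Conjecture 2 in the density window on homotopy 4-spheres).
* Card `ancient-window-rigidity`: `IsPinchedCurvatureOperator`, `AncientEventuallyPinchedIsRound`
  (first lemma: BHS 2011 Thm 2 + Hamilton's preserved pinching sets), `AncientWindowRigidity`.
* Card `end-density-ceiling` (refinement): `CurvatureVanishesAtInfinity`, `ACorSubcylindrical` (first lemma),
  `ACShrinkerGap`, `NoncompactShrinkerGapBdd`, `noncompactGapBdd_of_dichotomy` (PROVED).
* Card `cone-ceiling`: `ShrinkerLogDensityLeMu` (Li–Wang 2020 Thm 1.1 consequence, fact-shaped).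
-/

noncomputable section

namespace Summit.SmoothPoincare4.SmoothPoincare4.Cruxes.SubcylindricalRecognition.IdeateK3

open scoped BigOperators Topology Manifold Classical MeasureTheory ContDiff ENNReal NNReal ContinuousMap
open Filter Set Function TopologicalSpace MeasureTheory
open Literature.Geometry.Lorentzian Literature.Geometry.Riemannian Literature.Topology.FourManifolds

/-- The standard `S⁴ ⊂ ℝ⁵`. -/
abbrev S4 : Type := Metric.sphere (0 : EuclideanSpace ℝ (Fin 5)) 1

/-- Smooth metrics (as `PseudoRiemannianMetric`) on a `C^∞` 4-manifold `M` modelled on `ℝ⁴`. -/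
abbrev Met (M : Type) [TopologicalSpace M] [ChartedSpace (EuclideanSpace ℝ (Fin 4)) M]
    [IsManifold (𝓡 4) ∞ M] :=
  PseudoRiemannianMetric (𝓡 4) ∞ (EuclideanSpace ℝ (Fin 4)) (TangentSpace (𝓡 4) : M → Type _)

/-- Covariant derivatives on `TM`. -/
abbrev Cov (M : Type) [TopologicalSpace M] [ChartedSpace (EuclideanSpace ℝ (Fin 4)) M]
    [IsManifold (𝓡 4) ∞ M] :=
  CovariantDerivative (𝓡 4) (EuclideanSpace ℝ (Fin 4)) (TangentSpace (𝓡 4) : M → Type _)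

section Hypotheses

variable {M : Type} [TopologicalSpace M] [ChartedSpace (EuclideanSpace ℝ (Fin 4)) M]
  [IsManifold (𝓡 4) ∞ M] [T3Space M] [MeasurableSpace M] [BorelSpace M]

/-- The route's entropy hypothesis "ν(g) > ν_cyl", verbatim (rev 1 typing of `SubcylindricalRecognition`):
`∃ δ > 0 ∀ τ > 0 ∀ f` smooth compatible, `log 2 + ½ log π − 3/2 + δ ≤ 𝒲(g, f, τ)`. -/
def SuperCylindrical (g : Met M) [g.HasLeviCivita] (hg : g.IsRiemannian) : Prop :=
  ∃ δ : ℝ, 0 < δ ∧ ∀ τ : ℝ, 0 < τ → ∀ f : M → ℝ, ContMDiff (𝓡 4) 𝓘(ℝ, ℝ) ∞ f →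
    ∫ x, (4 * Real.pi * τ) ^ (-(4 : ℝ) / 2) * Real.exp (-f x)
        ∂(riemannianMeasure (g.toContMDiffRiemannianMetric hg)) = 1 →
      Real.log 2 + Real.log Real.pi / 2 - 3 / 2 + δ ≤
        ∫ x, (τ * (g.scalarCurvature x + g.gradSq f x) + f x - 4) *
          ((4 * Real.pi * τ) ^ (-(4 : ℝ) / 2) * Real.exp (-f x))
          ∂(riemannianMeasure (g.toContMDiffRiemannianMetric hg))

/-- `ν(g) = inf_{τ>0} μ(g, τ)` as an extended real, over an explicit connection `cov`
(`muEntropy` of `PerelmanEntropy.lean`). -/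
def nuInf (g : Met M) (cov : Cov M) : EReal := ⨅ τ : Ioi (0 : ℝ), g.muEntropy cov τ

end Hypotheses

/-! ## Card 1 — `stable-window-genericity` -/

/-- **Transfer C⁺ of card 1 (DenseRoundExit).** Near (here: `C⁰`-near, `|g' − g| ≤ ε g`) every
`R > 0`, entropically super-cylindrical metric on a closed 4-manifold `M ≃ₕ S⁴` there is a Riemannian
metric whose Ricci flow has a time-slice of positive curvature operator.  On `S⁴` itself this is a
non-vacuous density statement; on any `M` it implies the crux via Hamilton 1986 (`rung_of_denseRoundExit`). -/
def DenseRoundExit : Prop :=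
  ∀ (M : Type) [TopologicalSpace M] [T2Space M] [SecondCountableTopology M]
    [ChartedSpace (EuclideanSpace ℝ (Fin 4)) M] [IsManifold (𝓡 4) ∞ M] [CompactSpace M] [T3Space M]
    [MeasurableSpace M] [BorelSpace M],
    M ≃ₕ S4 → ∀ (g : Met M) [g.HasLeviCivita] (hg : g.IsRiemannian),
      (∀ x : M, 0 < g.scalarCurvature x) → SuperCylindrical g hg →
      ∀ ε : ℝ, 0 < ε → ∃ g' : Met M, g'.IsRiemannian ∧
        (∀ (x : M) (X : TangentSpace (𝓡 4) x), |g'.val x X X - g.val x X X| ≤ ε * g.val x X X) ∧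
        ∃ (G : ℝ → Met M) (cov : ℝ → Cov M) (T : ℝ), 0 < T ∧ IsRicciFlow G cov (Ico 0 T) ∧ G 0 = g' ∧
          ∃ t ∈ Ico (0 : ℝ) T, (G t).IsRiemannian ∧ (G t).HasPositiveCurvatureOperator

/-- **C⁺ ⇒ crux (proved).**  `DenseRoundExit` together with the named fact Hamilton 1986 Thm 1.1
(`hamilton_positiveCurvatureOperator_classification_four`) gives `SubcylindricalRecognition`;
`π₁(S⁴) = 1` is the tree theorem `simplyConnectedSpace_sphere_four_holds`. -/
theorem rung_of_denseRoundExit (hH : hamilton_positiveCurvatureOperator_classification_four)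
    (h : DenseRoundExit) : Theses.EntropyRung.SubcylindricalRecognition := by
  dsimp only [Theses.EntropyRung.SubcylindricalRecognition, DenseRoundExit, SuperCylindrical] at *
  intro M _ _ _ _ _ _ _ _ _ e g _ hg hR hν
  obtain ⟨g', hg', -, G, cov, T, hT, hflow, h0, t, ht, hGt, hPCO⟩ := h M e g hg hR hν 1 one_pos
  haveI : SimplyConnectedSpace M :=
    simplyConnectedSpace_of_homotopyEquiv_sphere_four simplyConnectedSpace_sphere_four_holds M e
  exact hamilton_positiveCurvatureOperator_sphere_four_of_classification hH M ⟨G t, hGt, hPCO⟩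

section CardOne

variable {M : Type} [TopologicalSpace M] [ChartedSpace (EuclideanSpace ℝ (Fin 4)) M]
  [IsManifold (𝓡 4) ∞ M] [T3Space M] [MeasurableSpace M] [BorelSpace M]

/-- **Curve-wise local maximality of `ν`** (between Cao–Zhu's linear `ν`-stability and Kröncke's
local maximality): along every jointly smooth one-parameter family of Riemannian metrics through `g`
(with Levi-Civita witnesses), `ν` does not exceed `ν(g)` for small parameters. -/
def IsCurvewiseNuMax (g : Met M) (cov : Cov M) : Prop :=
  ∀ (G : ℝ → Met M) (c : ℝ → Cov M), G 0 = g → IsContMDiffFamilyOn ∞ G (Ioo (-1) 1) →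
    (∀ s ∈ Ioo (-1 : ℝ) 1, (G s).IsRiemannian ∧ (G s).IsLeviCivita (c s)) →
    ∃ ε : ℝ, 0 < ε ∧ ∀ s : ℝ, |s| < ε → nuInf (G s) (c s) ≤ nuInf g cov

end CardOne

/-- **First lemma of card 1 (StableCompactWindow)** — Cao's Conjecture 2 (Cao 2006; Cao–Zhu 2024,
Conj. 2) in the density window on homotopy 4-spheres: a compact normalised gradient shrinker
(`Ric + Hess f = g/2`, `R + |∇f|² = f`) on `M ≃ₕ S⁴` with Gaussian density `> Θ(S³×ℝ)` which is a
curve-wise local maximum of `ν` is Einstein (`Hess f ≡ 0`); the Einstein case is then round by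
Hitchin–Gursky–Kuiper (route, crux #4 Einstein sub-case). -/
def StableCompactWindow : Prop :=
  ∀ (M : Type) [TopologicalSpace M] [T2Space M] [SecondCountableTopology M]
    [ChartedSpace (EuclideanSpace ℝ (Fin 4)) M] [IsManifold (𝓡 4) ∞ M] [CompactSpace M] [T3Space M]
    [MeasurableSpace M] [BorelSpace M],
    M ≃ₕ S4 → ∀ (g : Met M) [g.HasLeviCivita] (f : M → ℝ) (hg : g.IsRiemannian),
      ContMDiff (𝓡 4) 𝓘(ℝ, ℝ) ∞ f →
      (∀ (x : M) (X Y : TangentSpace (𝓡 4) x),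
          g.ricci x X Y + g.hessian f x X Y = (1 / 2 : ℝ) * g.val x X Y) →
      (∀ x : M, g.scalarCurvature x + g.gradSq f x = f x) →
      ENNReal.ofReal (32 * Real.pi ^ 2 * Real.sqrt Real.pi * Real.exp (-(3 : ℝ) / 2)) <
        ∫⁻ x, ENNReal.ofReal (Real.exp (-f x)) ∂(riemannianMeasure (g.toContMDiffRiemannianMetric hg)) →
      IsCurvewiseNuMax g g.leviCivita →
      ∀ (x : M) (X Y : TangentSpace (𝓡 4) x), g.hessian f x X Y = 0

/-! ## Card 2 — `ancient-window-rigidity` -/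

section CardTwo

variable {M : Type} [TopologicalSpace M] [ChartedSpace (EuclideanSpace ℝ (Fin 4)) M]
  [IsManifold (𝓡 4) ∞ M]

/-- **`ρ`-pinched positive curvature operator** (scale-invariant): for every 2-vector
`φ = Σₐ Xₐ ∧ Yₐ`, `Rm(φ, φ) ≥ ρ · R · |φ|²`, with `|φ|² = Σ_b φ♭(X_b, Y_b)` (`bivectorForm`,
`curvatureOperatorForm` of `CurvatureOperator.lean`).  For `ρ > 0` and `R > 0` this is a compact
subset of the interior of Hamilton's PCO cone; the round sphere has `ρ = 1/12`. -/
def IsPinchedCurvatureOperator (g : Met M) (cov : Cov M) (ρ : ℝ) : Prop :=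
  ∀ (x : M) (m : ℕ) (X Y : Fin m → TangentSpace (𝓡 4) x),
    ρ * g.scalarCurvatureWith cov x * (∑ b : Fin m, g.bivectorForm x X Y (X b) (Y b)) ≤
      g.curvatureOperatorForm cov x X Y

end CardTwo

/-- **First lemma of card 2 (AncientEventuallyPinchedIsRound).**  A compact ancient 4-dimensional Ricci
flow of Riemannian metrics of positive scalar curvature which is `ρ`-pinched (`ρ > 0` fixed) at a
sequence of times `t_k → −∞` has constant sectional curvature at every time.  (Hamilton 1986:
pinching sets are preserved forward, so the flow is uniformly pinched for all `t`; then
Brendle–Huisken–Sinestrari 2011, Thm 2.)  This is the closing step that turns "the tangent flow at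
`−∞` of the blow-up limit is the round `S⁴`" into "the blow-up limit IS the shrinking round sphere". -/
def AncientEventuallyPinchedIsRound : Prop :=
  ∀ (M : Type) [TopologicalSpace M] [T2Space M] [SecondCountableTopology M]
    [ChartedSpace (EuclideanSpace ℝ (Fin 4)) M] [IsManifold (𝓡 4) ∞ M] [CompactSpace M] [ConnectedSpace M]
    (G : ℝ → Met M) (cov : ℝ → Cov M),
    IsRicciFlow G cov (Iio 0) → (∀ t ∈ Iio (0 : ℝ), (G t).IsRiemannian) →
    (∀ t ∈ Iio (0 : ℝ), ∀ x : M, 0 < (G t).scalarCurvatureWith (cov t) x) →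
    (∃ ρ : ℝ, 0 < ρ ∧ ∀ T : ℝ, ∃ t : ℝ, t < T ∧ t < 0 ∧ IsPinchedCurvatureOperator (G t) (cov t) ρ) →
    ∀ t ∈ Iio (0 : ℝ), ∃ κ : ℝ, 0 < κ ∧ (G t).HasConstantSectionalCurvatureWith (cov t) κ

/-- **Line statement of card 2 (AncientWindowRigidity)** — classification of ancient solutions in the
entropy window, in the form the crux consumes: a complete ancient 4-d Ricci flow with bounded curvature
(frame bound `C` on every slice), positive scalar curvature and `μ(g(t), τ) ≥ ν_cyl + δ` for all
`t < 0`, `τ > 0` lives on a COMPACT manifold and has constant positive sectional curvature at each time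
(hence is the shrinking round `S⁴/Γ`; `Γ = 1` as `Θ(S⁴/Γ) ≤ .406 < Θ_cyl` for `Γ ≠ 1`).
κ-noncollapsing is implied by the entropy bound and not repeated. -/
def AncientWindowRigidity : Prop :=
  ∀ (M : Type) [TopologicalSpace M] [T2Space M] [SecondCountableTopology M]
    [ChartedSpace (EuclideanSpace ℝ (Fin 4)) M] [IsManifold (𝓡 4) ∞ M] [ConnectedSpace M] [T3Space M]
    [MeasurableSpace M] [BorelSpace M]
    (G : ℝ → Met M) (cov : ℝ → Cov M) (C δ : ℝ), 0 < δ →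
    IsRicciFlow G cov (Iio 0) → (∀ t ∈ Iio (0 : ℝ), (G t).IsRiemannian) →
    (∀ t ∈ Iio (0 : ℝ), ∀ hGt : (G t).IsRiemannian, ∀ (x : M) (r : NNReal),
        IsCompact {y : M | (G t).edist hGt x y ≤ r}) →
    (∀ t ∈ Iio (0 : ℝ), CurvatureBoundedBy (G t) (cov t) C) →
    (∀ t ∈ Iio (0 : ℝ), ∀ x : M, 0 < (G t).scalarCurvatureWith (cov t) x) →
    (∀ t ∈ Iio (0 : ℝ), ∀ τ : ℝ, 0 < τ →
        ((Real.log 2 + Real.log Real.pi / 2 - 3 / 2 + δ : ℝ) : EReal) ≤ (G t).muEntropy (cov t) τ) →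
    CompactSpace M ∧ ∀ t ∈ Iio (0 : ℝ), ∃ κ : ℝ, 0 < κ ∧ (G t).HasConstantSectionalCurvatureWith (cov t) κ

/-! ## Card 3 — `end-density-ceiling` -/

section CardThree

variable {M : Type} [TopologicalSpace M] [ChartedSpace (EuclideanSpace ℝ (Fin 4)) M]
  [IsManifold (𝓡 4) ∞ M]

/-- `|Rm| → 0` at infinity (frame form, as in `CurvatureBoundedBy`): for every `ε > 0` the curvature is
`ε`-bounded on `g`-unit vectors outside some compact set. -/
def CurvatureVanishesAtInfinity (g : Met M) (cov : Cov M) : Prop :=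
  ∀ ε : ℝ, 0 < ε → ∃ K : Set M, IsCompact K ∧ ∀ x ∉ K, ∀ (X Y Z W : TangentSpace (𝓡 4) x),
    g.val x X X ≤ 1 → g.val x Y Y ≤ 1 → g.val x Z Z ≤ 1 → g.val x W W ≤ 1 →
      |g.curvatureForm cov x X Y Z W| ≤ ε

end CardThree

/-- Common hypothesis block of the non-compact shrinker statements (route crux #2 verbatim, plus a
global curvature bound `C`): complete non-compact connected normalised shrinker with `R ≢ 0`. -/
def NoncompactShrinkerWith (P : ∀ (M : Type) [TopologicalSpace M] [ChartedSpace (EuclideanSpace ℝ (Fin 4)) M]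
      [IsManifold (𝓡 4) ∞ M] [T3Space M] [MeasurableSpace M] [BorelSpace M]
      (g : Met M) (_ : Cov M) (_ : M → ℝ) (_ : g.IsRiemannian), Prop) : Prop :=
  ∀ (M : Type) [TopologicalSpace M] [T2Space M] [SecondCountableTopology M]
    [ChartedSpace (EuclideanSpace ℝ (Fin 4)) M] [IsManifold (𝓡 4) ∞ M] [ConnectedSpace M]
    [NoncompactSpace M] [T3Space M] [MeasurableSpace M] [BorelSpace M]
    (g : Met M) [g.HasLeviCivita] (f : M → ℝ) (hg : g.IsRiemannian) (C : ℝ),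
    (∀ (x : M) (r : NNReal), IsCompact {y : M | g.edist hg x y ≤ r}) →
    ContMDiff (𝓡 4) 𝓘(ℝ, ℝ) ∞ f →
    (∀ (x : M) (X Y : TangentSpace (𝓡 4) x),
        g.ricci x X Y + g.hessian f x X Y = (1 / 2 : ℝ) * g.val x X Y) →
    (∀ x : M, g.scalarCurvature x + g.gradSq f x = f x) →
    (∃ x : M, g.scalarCurvature x ≠ 0) →
    CurvatureBoundedBy g g.leviCivita C →
    P M g g.leviCivita f hg

/-- The route's density conclusion `(4π)⁻² ∫ e^{−f} dV ≤ Θ(S³×ℝ)`, verbatim. -/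
def SubcylindricalDensity (M : Type) [TopologicalSpace M] [ChartedSpace (EuclideanSpace ℝ (Fin 4)) M]
    [IsManifold (𝓡 4) ∞ M] [T3Space M] [MeasurableSpace M] [BorelSpace M]
    (g : Met M) (f : M → ℝ) (hg : g.IsRiemannian) : Prop :=
  ∫⁻ x, ENNReal.ofReal (Real.exp (-f x)) ∂(riemannianMeasure (g.toContMDiffRiemannianMetric hg)) ≤
    ENNReal.ofReal (32 * Real.pi ^ 2 * Real.sqrt Real.pi * Real.exp (-(3 : ℝ) / 2))

/-- **First lemma of card 3 (ACorSubcylindrical)** — the end-density ceiling in dichotomy form: a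
complete non-compact non-flat 4-d normalised shrinker with bounded curvature either has Gaussian density
`≤ Θ(S³×ℝ)` or has `|Rm| → 0` at infinity (hence, by Munteanu–Wang 2017 / Kotschwar–Wang 2015, is
smoothly asymptotic to a cone).  Proof sketch: Naber's splitting `(M, g, x_i) → ℝ × N³` along an end,
`N³ ∈ {S³/Γ, (S²×ℝ)/Γ, ℝ³}`; if some `N` is non-flat, transplanting its normalised potential gives
`log Θ(M) = μ(M,1) ≤ μ(ℝ×N,1) = log Θ(N) ≤ log Θ(S³×ℝ)` (Li–Wang 2020 (2.5), Thm 1.1). -/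
def ACorSubcylindrical : Prop :=
  NoncompactShrinkerWith fun M _ _ _ _ _ _ g cov f hg =>
    SubcylindricalDensity M g f hg ∨ CurvatureVanishesAtInfinity g cov

/-- **ACShrinkerGap** — route crux #2 restricted to asymptotically conical (here: curvature-vanishing,
bounded-curvature) shrinkers: the only survivors of the ceiling. -/
def ACShrinkerGap : Prop :=
  NoncompactShrinkerWith fun M _ _ _ _ _ _ g cov f hg =>
    CurvatureVanishesAtInfinity g cov → SubcylindricalDensity M g f hg

/-- Route crux #2 (`NoncompactShrinkerGap`) with the extra hypothesis of bounded curvature — the form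
in which cards 2 (bounded-curvature blow-up limits) and `type-split` consume it. -/
def NoncompactShrinkerGapBdd : Prop :=
  NoncompactShrinkerWith fun M _ _ _ _ _ _ g _ f hg => SubcylindricalDensity M g f hg

/-- **Dichotomy + AC gap ⇒ bounded-curvature non-compact gap (proved).** -/
theorem noncompactGapBdd_of_dichotomy (h₁ : ACorSubcylindrical) (h₂ : ACShrinkerGap) :
    NoncompactShrinkerGapBdd := by
  dsimp only [NoncompactShrinkerGapBdd, ACorSubcylindrical, ACShrinkerGap, NoncompactShrinkerWith] at *
  intro M _ _ _ _ _ _ _ _ _ _ g inst f hg C hballs hf hsol hnorm hR hC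
  rcases h₁ M g f hg C hballs hf hsol hnorm hR hC with h | h
  · exact h
  · exact h₂ M g f hg C hballs hf hsol hnorm hR hC h

/-- Sanity: the route's crux #2 (no curvature hypothesis) implies the bounded-curvature form. -/
theorem noncompactGapBdd_of_route (h : Theses.EntropyRung.NoncompactShrinkerGap) :
    NoncompactShrinkerGapBdd := by
  dsimp only [NoncompactShrinkerGapBdd, NoncompactShrinkerWith, SubcylindricalDensity,
    Theses.EntropyRung.NoncompactShrinkerGap] at *
  intro M _ _ _ _ _ _ _ _ _ _ g inst f hg C hballs hf hsol hnorm hR _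
  exact h M g f hg hballs hf hsol hnorm hR


/-! ## Card 4 — `cone-ceiling` (entropy at scales τ → ∞) -/

/-- **Load-bearing fact of card 4 (ShrinkerLogDensityLeMu)** — the consequence of Li–Wang 2020 Thm 1.1 that drives both
ceilings: on a complete normalised gradient shrinker (`Ric + Hess f = g/2`, `R + |∇f|² = f`, closed balls compact, bounded
curvature) `μ(g, τ)` is minimised at `τ = 1`, where it equals the log-density; hence for EVERY scale `τ > 0`
`log((4π)⁻² ∫ e^{−f} dV) ≤ μ(g, τ)` — so every compatible test function at every scale bounds the Gaussian density from
above (basepoints → ∞ at scale 1: end ceiling; scales → ∞ under the blow-down to the asymptotic cone: cone ceiling). -/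
def ShrinkerLogDensityLeMu : Prop :=
  ∀ (M : Type) [TopologicalSpace M] [T2Space M] [SecondCountableTopology M]
    [ChartedSpace (EuclideanSpace ℝ (Fin 4)) M] [IsManifold (𝓡 4) ∞ M] [ConnectedSpace M]
    [T3Space M] [MeasurableSpace M] [BorelSpace M]
    (g : Met M) [g.HasLeviCivita] (f : M → ℝ) (hg : g.IsRiemannian) (C : ℝ),
    (∀ (x : M) (r : NNReal), IsCompact {y : M | g.edist hg x y ≤ r}) →
    ContMDiff (𝓡 4) 𝓘(ℝ, ℝ) ∞ f →
    (∀ (x : M) (X Y : TangentSpace (𝓡 4) x),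
        g.ricci x X Y + g.hessian f x X Y = (1 / 2 : ℝ) * g.val x X Y) →
    (∀ x : M, g.scalarCurvature x + g.gradSq f x = f x) →
    CurvatureBoundedBy g g.leviCivita C →
    ∀ τ : ℝ, 0 < τ →
      ((Real.log ((∫⁻ x, ENNReal.ofReal (Real.exp (-f x))
          ∂(riemannianMeasure (g.toContMDiffRiemannianMetric hg))).toReal / (16 * Real.pi ^ 2)) : ℝ) : EReal)
        ≤ g.muEntropy g.leviCivita τ

end Summit.SmoothPoincare4.SmoothPoincare4.Cruxes.SubcylindricalRecognition.IdeateK3
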